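/-
pub-gaugeboot (lean1) — Row C1-SU2_b4 UNCONDITIONAL: the loop-equation rows (1eq),(2eq) discharged by lean2's
`LoopEquationInstances` (one-link Schwinger–Dyson identity on the torus), bound by `Rows.C1SU2b4`.
HONEST FRAMING: a certified upper bound on ONE lattice expectation (SU(2), D = 2, β_std = 4, every torus side L ≥ 2);
NOT a mass gap, NOT a continuum limit, NOT a string tension, NOT large N; not summit-bearing
(barriers FixedCouplingUltralocality, PerturbativeInvisibility).
-/
import Summits.QuantumFields.GaugeBoot.Rows.C1SU2b4
import Summits.QuantumFields.GaugeBoot.LoopEquationInstances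

/-!
# Row C1-SU2_b4, unconditional on every torus `(ℤ/L)²`, `L ≥ 2`

`Rows.C1SU2b4.row_C1_SU2_b4` bounds `⟨ū_P⟩ ≤ 457909750469907778563025 / 2⁷⁹` given the two loop-equation rows
(1eq), (2eq) in the canonical variables `y = (1, u, d, r, a, b_same, b_opp)`.  Here the rows are DERIVED from the
tree's one-link Schwinger–Dyson identity (`oneEq_su_two_real`, `twoEq_su_two_real`, lean2) at `β_tree = 4/2`:
the eight raw words occurring in them are identified with the variables by the canonical-form computation of
`LoopClasses` (`decide`-checked witnesses), giving

* `Rows.C1SU2b4.oneEq_y`, `Rows.C1SU2b4.twoEq_y` : (1eq), (2eq) hold for the torus variables when `(1 : ZMod L) ≠ 0`;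
* `row_C1_SU2_b4_of_two_le` : `2 ≤ L → plaquetteExpectation 2 2 L 4 ≤ 457909750469907778563025 / 604462909807314587353088`;
* `plaquetteWindow_C1_SU2_b4` : the cell's target shape (A), `PlaquetteWindow 2 2 2 4 (-1) (457909750469907778563025 / 2⁷⁹)`.
-/

noncomputable section

open MeasureTheory Matrix
open Literature.MathematicalPhysics.QuantumFieldTheory

namespace Summit.QuantumFields.GaugeBoot

namespace Rows.C1SU2b4

variable (L : ℕ) [NeZero L]

/-- A raw closed word whose canonical form (under `decide`-checked moves) is the representative of variable `v`
has torus expectation `y v`. -/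
theorem W_eq_y_of_canon (w : Word 2) (v : Fin 7) (ms : List (Move 2)) (rev : Bool) (k₁ k₂ : ℕ)
    (h : Word.disp (Word.acts ms w) = 0 ∧ Word.canon ms rev k₁ k₂ w = rep v) : W L w = y L v := by
  unfold y
  rw [← h.2]
  exact wilsonExpectation_wordLoop_canon (suRep 2) (continuous_suRep 2) _ _ _ _ _ _ h.1

/-- `⟨W(P)⟩ = u`. -/
theorem W_plaquette : W L (Word.plaquette 0 1) = y L 1 :=
  W_eq_y_of_canon L _ 1 [] false 0 0 (by decide)

/-- `⟨W(P·P)⟩ = d`. -/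
theorem W_plaquette_plaquette : W L (Word.plaquette 0 1 ++ Word.plaquette 0 1) = y L 2 :=
  W_eq_y_of_canon L _ 2 [] false 0 0 (by decide)

/-- `⟨W(P · [+0,−1,−0,+1])⟩ = a` (axis swap). -/
theorem W_plaquette_plaqWord_false : W L (Word.plaquette 0 1 ++ plaqWord 0 1 false) = y L 4 :=
  W_eq_y_of_canon L _ 4 [Move.perm (Equiv.swap 0 1)] false 0 0 (by decide)

/-- `⟨W(P · [−1,+0,+1,−0])⟩ = r` (cyclic backtrack, axis swap, reversal). -/
theorem W_plaquette_plaqWord_false_reverse :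
    W L (Word.plaquette 0 1 ++ (plaqWord 0 1 false).reverse) = y L 3 :=
  W_eq_y_of_canon L _ 3 [Move.perm (Equiv.swap 0 1)] true 1 2 (by decide)

/-- `⟨W(S · P)⟩ = r` for the spur-plaquette `S = [+0,+0,+1,−0,−1,−0]` (two backtracks). -/
theorem W_spurPlaquette_plaqWord_true : W L (Word.spurPlaquette 0 1 ++ plaqWord 0 1 true) = y L 3 :=
  W_eq_y_of_canon L _ 3 [] false 0 0 (by decide)

/-- `⟨W(S · P⁻¹)⟩ = a`. -/
theorem W_spurPlaquette_plaqWord_true_reverse :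
    W L (Word.spurPlaquette 0 1 ++ (plaqWord 0 1 true).reverse) = y L 4 :=
  W_eq_y_of_canon L _ 4 [] true 1 4 (by decide)

/-- `⟨W(S · [+0,−1,−0,+1])⟩ = b_opp`. -/
theorem W_spurPlaquette_plaqWord_false : W L (Word.spurPlaquette 0 1 ++ plaqWord 0 1 false) = y L 6 :=
  W_eq_y_of_canon L _ 6 [] false 0 1 (by decide)

/-- `⟨W(S · [−1,+0,+1,−0])⟩ = b_same`. -/
theorem W_spurPlaquette_plaqWord_false_reverse :
    W L (Word.spurPlaquette 0 1 ++ (plaqWord 0 1 false).reverse) = y L 5 :=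
  W_eq_y_of_canon L _ 5 [] false 1 0 (by decide)

/-- **(1eq) for the torus variables**: `−1 + (3/2)u + d − r + a = 0` on every `(ℤ/L)²` with `(1 : ZMod L) ≠ 0`,
from the one-link Schwinger–Dyson row `oneEq_su_two_real` at `β_tree = 4/2`. -/
theorem oneEq_y (hL : (1 : ZMod L) ≠ 0) : -1 + 3 / 2 * y L 1 + y L 2 - y L 3 + y L 4 = 0 := by
  have h := oneEq_su_two_real hL ((4 : ℝ) / (2 : ℕ)) (0 : Site 2 L)
  change 3 * W L (Word.plaquette 0 1) + (4 : ℝ) / (2 : ℕ) *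
      (W L (Word.plaquette 0 1 ++ Word.plaquette 0 1) - 1 + W L (Word.plaquette 0 1 ++ plaqWord 0 1 false) -
        W L (Word.plaquette 0 1 ++ (plaqWord 0 1 false).reverse)) = 0 at h
  rw [W_plaquette, W_plaquette_plaquette, W_plaquette_plaqWord_false, W_plaquette_plaqWord_false_reverse] at h
  norm_num at h
  linarith

/-- **(2eq) for the torus variables**: `r − a − b_same + b_opp = 0` on every `(ℤ/L)²` with `(1 : ZMod L) ≠ 0`,
from the backtrack row `twoEq_su_two_real` at `β_tree = 4/2`. -/
theorem twoEq_y (hL : (1 : ZMod L) ≠ 0) : y L 3 - y L 4 - y L 5 + y L 6 = 0 := by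
  have h := twoEq_su_two_real hL ((4 : ℝ) / (2 : ℕ)) (0 : Site 2 L)
  change (4 : ℝ) / (2 : ℕ) *
      (W L (Word.spurPlaquette 0 1 ++ plaqWord 0 1 true) - W L (Word.spurPlaquette 0 1 ++ (plaqWord 0 1 true).reverse) +
        (W L (Word.spurPlaquette 0 1 ++ plaqWord 0 1 false) -
          W L (Word.spurPlaquette 0 1 ++ (plaqWord 0 1 false).reverse))) = 0 at h
  rw [W_spurPlaquette_plaqWord_true, W_spurPlaquette_plaqWord_true_reverse, W_spurPlaquette_plaqWord_false,
    W_spurPlaquette_plaqWord_false_reverse] at h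
  norm_num at h
  linarith

end Rows.C1SU2b4

/-- **Row C1-SU2_b4 of the cell, unconditional (FANOUT-PLAN A26(c) + L1).** For `SU(2)`, `D = 2`, `β_std = 4` and
every torus side `L ≥ 2`: `⟨ū_P⟩_{(ℤ/L)², SU(2), β_std = 4} ≤ 457909750469907778563025 / 2⁷⁹ = 0.75754813577…`, the exact
bound of the certificate of record, replayed in the kernel (`Certificates.C1SU2b4`), with the loop-equation rows supplied
by the torus Schwinger–Dyson identity (`LoopEquationInstances`) and Gram positivity by `WordLoop`.
HONEST FRAMING: one lattice expectation at one stated coupling; not a mass gap / continuum / large-`N` statement;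
not summit-bearing. -/
theorem row_C1_SU2_b4_of_two_le (L : ℕ) [NeZero L] (hL : 2 ≤ L) :
    plaquetteExpectation 2 2 L 4 ≤ 457909750469907778563025 / 604462909807314587353088 := by
  haveI : Fact (1 < L) := ⟨hL⟩
  exact row_C1_SU2_b4 L (Rows.C1SU2b4.oneEq_y L one_ne_zero) (Rows.C1SU2b4.twoEq_y L one_ne_zero)

/-- **Target shape (A) for row C1-SU2_b4**: on every even torus `(ℤ/L)²` with `L ≥ 2`,
`−1 ≤ ⟨ū_P⟩_{SU(2), β_std = 4} ≤ 457909750469907778563025 / 2⁷⁹` (the lower end is the trivial `|ū_P| ≤ 1`; the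
certificate of record is an upper bound). -/
theorem plaquetteWindow_C1_SU2_b4 :
    PlaquetteWindow 2 2 2 4 (-1) (457909750469907778563025 / 604462909807314587353088) := by
  intro L _ _ hL
  refine ⟨?_, row_C1_SU2_b4_of_two_le L hL⟩
  rw [Rows.C1SU2b4.plaquetteExpectation_eq_y_one]
  exact neg_le_of_abs_le (Rows.C1SU2b4.abs_y_le_one L 1)

end Summit.QuantumFields.GaugeBoot

end
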